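import Summits.AtomisticToContinuum.Crystallization.Theorems.ChargedEnergyGapPeriodicRefolding
import HarnessLib

/-!
# Charged energy gap — lens-3 g63, part P-X: NORMALISATION of the rotation instances of (H𝄪ˢ) and their GEOMETRIC CHARGING FORM

Cell `decomp-a2c`, seat lens-3, generation 63, node «ROTATION FAMILY ⟸ FAR-RESIDUE BOUND», part P-X (over the tree's P-W
`…Theorems.ChargedEnergyGapPeriodicRefolding`).  ELEMENTARY·PROVED (`[this work]`, no `sorry`, no new axioms).

THE POINT.  P-P's `localS_conclusion_rotField_of_charging` reduces every rotation instance `(β₀, k) = (W_{r₀,v}, 0)` of (H𝄪ˢ)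
`LocalSeamTransferBoundS` to the charging inequality `λ·(‖r₀‖‖v‖)²·excisionMassL ≤ C_T·shellMassL + Cχ·transMassL + C_H·pricedNearCountL`.
As registered that inequality is FALSE for want of normalisation: `W_{r₀,v} = v ⊗ r₀ − r₀ ⊗ v` only sees `r₀ ∧ v`, so a nearly parallel pair
with huge norms generates the same small cocycle (`W_{r₀, v + c·r₀} = W_{r₀, v}`, `rotField_add_smul`) while `(‖r₀‖‖v‖)²` is unbounded — the
hypothesis `SmallStrain τ` constrains `W`, not the pair.  This file removes the pair from the inequality:
§X1 NORMALISATION — shear invariance `rotField_add_smul`; every rotation cocycle has an ORTHOGONAL generating pair with the same axis vector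
  (`exists_orthogonal_generator`); for an orthogonal pair `W r₀ = ‖r₀‖²·v` (`rotField_self_of_orthogonal`), so the operator norm `‖r₀‖‖v‖`
  is attained on the bond `r₀`.
§X2 ★★ LATTICE DENSITY — `SmallStrain τ P X W` only speaks about REALISED non-excised bonds; at a non-excised site `y` the bonds `(y, y + g)`,
  `g ∈ Λ_P`, are realised and non-excised (`X` is `Λ_P`-invariant), so `‖W g‖ ≤ τ‖g‖` on the period lattice
  (`smallStrain_rotField_lattice`); the lattice has full rank, every vector is within a uniform distance of it (`exists_lattice_near`,
  Mathlib's `ZSpan.floor` in a `ℤ`-basis), and dividing `‖W(n·x)‖ ≤ τ‖gₙ‖ + O(1)` by `n → ∞` gives `‖W x‖ ≤ τ‖x‖` for EVERY `x ∈ ℝ³`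
  (`smallStrain_rotField_linear_bound`) — hence `‖r₀‖‖v‖ ≤ τ` for an orthogonal pair as soon as ONE site is non-excised
  (`norm_mul_norm_le_of_smallStrain`); if none is, the excision mass vanishes.
§X3 ★★ THE GEOMETRIC CHARGING FORM — `modelFarL(W_{r₀,v}) ≥ −λ·τ²·excisionMassL` with NO dependence on the pair
  (`modelFarL_rotField_ge_smallStrain`), so the rotation instance holds as soon as `λ·τ²·excisionMassL ≤ C_T·shellMassL + Cχ·transMassL +
  C_H·pricedNearCountL` (`localS_conclusion_rotField_of_geomCharging`) — a statement about the reference geometry, the excised set and the weights only.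
§X4 THE ROTATION SUB-FAMILY `RotationFamilyS` of (H𝄪ˢ) (its instances with `β₀ := W_{r₀,v}`, `k := 0`, all binders verbatim; (H𝄪ˢ) ⟹ it by
  specialisation, `rotationFamilyS_of_localS`) and ★★ `rotationFamilyS_of_excisionCharging`: a charging bound UNIFORM over admissible invariant
  data, `ExcisionChargingBound s lam ℓ ϱ ϱχ A_T A_χ A_H` (`excisionMassL ≤ A_T·shellMassL + A_χ·transMassL + A_H·pricedNearCountL`), with
  `λτ²A_T ≤ C_T`, `λτ²A_χ ≤ Cχ`, gives the whole rotation sub-family with `C_H := λτ²·A_H`.  Part P-Y splits `excisionMassL` into a NEAR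
  part charged to `pricedNearCountL` in the kernel and a FAR residue, the one remaining geometric statement.
Record (`(s, τ, λ, C_T, Cχ) = (3/5, 3/100, 1/2, 1/(3·10⁶), 10⁻⁵)`): `λτ² = 4.5·10⁻⁴`, admissible `A_T ≤ 1/1350`, `A_χ ≤ 1/45` (`record_geomCharging_dials`).
-/

noncomputable section

open scoped Classical

open Literature.MathematicalPhysics.StatisticalMechanics Literature.Geometry.DiscreteGeometry
open Summit.AtomisticToContinuum.Crystallization.Theses.PricedLinkCensus
open Summit.AtomisticToContinuum.Crystallization.Theorems.ChargedEnergyGapNegative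

namespace Summit.AtomisticToContinuum.Crystallization.Theorems.ChargedEnergyGapChartDial

/-! ## §X1 Normalisation of the generating pair -/

section Normalisation

/-- The rotation cocycle depends on the bond vector only: `W_{r₀,v}(y, y + g) = W_{r₀,v}(0, g)`. -/
theorem rotField_add_right (r₀ v y g : E3) : rotField r₀ v y (y + g) = rotField r₀ v 0 g := by
  simp [rotField, add_sub_cancel_left]

/-- Additivity in the bond vector. -/
theorem rotField_zero_add (r₀ v x x' : E3) : rotField r₀ v 0 (x + x') = rotField r₀ v 0 x + rotField r₀ v 0 x' := by
  simp only [rotField, sub_zero, inner_add_left, add_smul]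
  abel

/-- Homogeneity in the bond vector. -/
theorem rotField_zero_smul (r₀ v : E3) (c : ℝ) (x : E3) : rotField r₀ v 0 (c • x) = c • rotField r₀ v 0 x := by
  simp only [rotField, sub_zero, real_inner_smul_left, smul_sub, smul_smul]

/-- ★ SHEAR INVARIANCE of the generating pair: `W_{r₀, v + c·r₀} = W_{r₀, v}` — the cocycle only sees `r₀ ∧ v`, so `(‖r₀‖‖v‖)²` is NOT a
function of the cocycle (the defect of the charging inequality as registered in P-P). -/
theorem rotField_add_smul (r₀ v : E3) (c : ℝ) : rotField r₀ (v + c • r₀) = rotField r₀ v := by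
  funext y z
  simp only [rotField, inner_add_right, real_inner_smul_right, smul_add, add_smul, smul_smul]
  rw [mul_comm (inner ℝ (z - y) r₀) c]
  abel

/-- ★ ORTHOGONAL GENERATOR: every rotation cocycle is generated by a pair `(r₀, v')` with `⟪r₀, v'⟫ = 0` and the same axis vector `r₀`
(Gram–Schmidt on `v`). -/
theorem exists_orthogonal_generator (r₀ v : E3) : ∃ v' : E3, inner ℝ r₀ v' = 0 ∧ rotField r₀ v' = rotField r₀ v := by
  by_cases hr : r₀ = 0
  · exact ⟨v, by simp [hr], rfl⟩
  · refine ⟨v + (-(inner ℝ r₀ v) / ‖r₀‖ ^ 2) • r₀, ?_, rotField_add_smul r₀ v _⟩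
    have hn : ‖r₀‖ ^ 2 ≠ 0 := pow_ne_zero 2 (norm_ne_zero_iff.2 hr)
    rw [inner_add_right, real_inner_smul_right, real_inner_self_eq_norm_sq]
    field_simp
    ring

/-- For an orthogonal pair the cocycle on the bond `r₀` is `‖r₀‖²·v` … -/
theorem rotField_self_of_orthogonal {r₀ v : E3} (h : inner ℝ r₀ v = 0) : rotField r₀ v 0 r₀ = (‖r₀‖ ^ 2) • v := by
  simp only [rotField, sub_zero, real_inner_self_eq_norm_sq, h, zero_smul]

/-- … of norm `‖r₀‖²·‖v‖`: the operator norm `‖r₀‖‖v‖` of `W_{r₀,v}` (orthogonal pair) is ATTAINED on the bond `r₀`. -/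
theorem norm_rotField_self_of_orthogonal {r₀ v : E3} (h : inner ℝ r₀ v = 0) : ‖rotField r₀ v 0 r₀‖ = ‖r₀‖ ^ 2 * ‖v‖ := by
  rw [rotField_self_of_orthogonal h, norm_smul, Real.norm_eq_abs, abs_of_nonneg (sq_nonneg _)]

end Normalisation

/-! ## §X2 ★★ Lattice density: the strain bound extends from realised lattice bonds to every vector -/

section LatticeDensity

/-- ★ Every vector of `ℝ³` is within a UNIFORM distance of the period lattice (full rank: round the coordinates down in a `ℤ`-basis,
Mathlib `ZSpan.floor` / `ZSpan.norm_fract_le`). [folklore] -/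
theorem exists_lattice_near (P : PeriodicConfiguration 3) : ∃ M : ℝ, 0 ≤ M ∧ ∀ w : E3, ∃ g ∈ P.lattice, ‖w - g‖ ≤ M := by
  let b := Module.Free.chooseBasis ℤ P.lattice
  let B := b.ofZLatticeBasis ℝ P.lattice
  have hB : Submodule.span ℤ (Set.range B) = P.lattice := Module.Basis.ofZLatticeBasis_span ℝ P.lattice b
  refine ⟨∑ i, ‖B i‖, Finset.sum_nonneg fun i _ => norm_nonneg _, fun w => ⟨(ZSpan.floor B w : E3), hB.le (ZSpan.floor B w).2, ?_⟩⟩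
  have h := ZSpan.norm_fract_le B w
  rwa [ZSpan.fract_apply] at h

variable {P : PeriodicConfiguration 3} {X : Set E3} {τ : ℝ} {r₀ v : E3}

/-- `SmallStrain` read on the PERIOD BONDS at a non-excised site: `‖W g‖ ≤ τ‖g‖` for every `g ∈ Λ_P` (the bond `(y, y + g)` is realised,
and non-excised because `X` is `Λ_P`-invariant). -/
theorem smallStrain_rotField_lattice (hW : SmallStrain τ P X (rotField r₀ v)) (hX : IsInvariantSet P X) {y : E3} (hy : y ∈ P.points)
    (hyX : y ∉ X) {g : E3} (hg : g ∈ P.lattice) : ‖rotField r₀ v 0 g‖ ≤ τ * ‖g‖ := by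
  have hyg : y + g ∈ P.points := P.add_mem_points hy hg
  have hygX : y + g ∉ X := fun h => hyX ((hX g hg y).1 h)
  have h := hW y hy (y + g) hyg hyX hygX
  rwa [rotField_add_right, dist_eq_norm, sub_add_cancel_left, norm_neg] at h

/-- ★★ **THE STRAIN BOUND ON ALL OF `ℝ³`.**  If some site is non-excised, `‖W_{r₀,v} x‖ ≤ τ‖x‖` for EVERY vector `x`: lattice vectors `gₙ`
approximate `n·x` within `M` (`exists_lattice_near`), `n‖W x‖ ≤ ‖W gₙ‖ + ‖W(n·x − gₙ)‖ ≤ τ(n‖x‖ + M) + 2‖r₀‖‖v‖M`, divide by `n → ∞`. -/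
theorem smallStrain_rotField_linear_bound (hτ : 0 ≤ τ) (hW : SmallStrain τ P X (rotField r₀ v)) (hX : IsInvariantSet P X) {y : E3}
    (hy : y ∈ P.points) (hyX : y ∉ X) (x : E3) : ‖rotField r₀ v 0 x‖ ≤ τ * ‖x‖ := by
  obtain ⟨M, hM0, hM⟩ := exists_lattice_near P
  set K : ℝ := τ * M + 2 * (‖r₀‖ * ‖v‖) * M with hK
  have hK0 : 0 ≤ K := by positivity
  have key : ∀ n : ℕ, (n : ℝ) * ‖rotField r₀ v 0 x‖ ≤ τ * ((n : ℝ) * ‖x‖) + K := by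
    intro n
    obtain ⟨g, hg, hgx⟩ := hM ((n : ℝ) • x)
    have hWg := smallStrain_rotField_lattice hW hX hy hyX hg
    have hsplit : rotField r₀ v 0 ((n : ℝ) • x) = rotField r₀ v 0 g + rotField r₀ v 0 ((n : ℝ) • x - g) := by
      rw [← rotField_zero_add, add_sub_cancel]
    have herr : ‖rotField r₀ v 0 ((n : ℝ) • x - g)‖ ≤ 2 * (‖r₀‖ * ‖v‖) * M := by
      have h := norm_rotField_le r₀ v 0 ((n : ℝ) • x - g)
      rw [dist_eq_norm, zero_sub, norm_neg] at h
      exact h.trans (mul_le_mul_of_nonneg_left hgx (by positivity))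
    have hgn : ‖g‖ ≤ (n : ℝ) * ‖x‖ + M := by
      have h1 : ‖g‖ ≤ ‖(n : ℝ) • x‖ + ‖(n : ℝ) • x - g‖ := by
        have h := norm_sub_le ((n : ℝ) • x) ((n : ℝ) • x - g)
        rwa [sub_sub_cancel] at h
      rw [norm_smul, Real.norm_eq_abs, abs_of_nonneg (Nat.cast_nonneg n)] at h1
      linarith
    calc (n : ℝ) * ‖rotField r₀ v 0 x‖ = ‖rotField r₀ v 0 ((n : ℝ) • x)‖ := by
          rw [rotField_zero_smul, norm_smul, Real.norm_eq_abs, abs_of_nonneg (Nat.cast_nonneg n)]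
      _ ≤ ‖rotField r₀ v 0 g‖ + ‖rotField r₀ v 0 ((n : ℝ) • x - g)‖ := by
          rw [hsplit]
          exact norm_add_le _ _
      _ ≤ τ * ‖g‖ + 2 * (‖r₀‖ * ‖v‖) * M := add_le_add hWg herr
      _ ≤ τ * ((n : ℝ) * ‖x‖ + M) + 2 * (‖r₀‖ * ‖v‖) * M := by gcongr
      _ = τ * ((n : ℝ) * ‖x‖) + K := by
          rw [hK]
          ring
  refine le_of_forall_pos_lt_add fun ε hε => ?_
  obtain ⟨n, hn⟩ := exists_nat_gt (K / ε)
  have hn0 : (0 : ℝ) < n := lt_of_le_of_lt (div_nonneg hK0 hε.le) hn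
  have hKn : K < (n : ℝ) * ε := (div_lt_iff₀ hε).1 hn
  have h := key n
  by_contra hc
  push Not at hc
  have h2 := mul_le_mul_of_nonneg_left hc hn0.le
  linarith

/-- ★★ Hence for an ORTHOGONAL generating pair under `SmallStrain τ` with one non-excised site: `‖r₀‖‖v‖ ≤ τ`. -/
theorem norm_mul_norm_le_of_smallStrain (hτ : 0 ≤ τ) (hW : SmallStrain τ P X (rotField r₀ v)) (hX : IsInvariantSet P X) {y : E3}
    (hy : y ∈ P.points) (hyX : y ∉ X) (h : inner ℝ r₀ v = 0) : ‖r₀‖ * ‖v‖ ≤ τ := by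
  by_cases hr : r₀ = 0
  · simp [hr, hτ]
  · have hpos : 0 < ‖r₀‖ := norm_pos_iff.2 hr
    have h1 := smallStrain_rotField_linear_bound hτ hW hX hy hyX r₀
    rw [norm_rotField_self_of_orthogonal h] at h1
    have h2 : ‖r₀‖ * (‖r₀‖ * ‖v‖) ≤ ‖r₀‖ * τ := by
      calc ‖r₀‖ * (‖r₀‖ * ‖v‖) = ‖r₀‖ ^ 2 * ‖v‖ := by ring
        _ ≤ τ * ‖r₀‖ := h1
        _ = ‖r₀‖ * τ := mul_comm _ _
    exact le_of_mul_le_mul_left h2 hpos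

end LatticeDensity

/-! ## §X3 ★★ The geometric charging form of the rotation instances -/

section GeomCharging

variable (ϱχ : ℝ) {m : ℕ} (D : Fin m → Set E3) (σ : Fin m → Bool) {P : PeriodicConfiguration 3} (X : Set E3) (ϱ : ℝ) (C : Set E3)

/-- If every motif site is excised, the excision mass vanishes. -/
theorem excisionMassL_eq_zero_of_motif_subset (h : ∀ y ∈ P.motif, y ∈ X) : excisionMassL ϱχ D σ P X ϱ C = 0 :=
  Finset.sum_eq_zero fun y hy => if_pos (h y hy)

/-- ★★ **THE ROTATION INSTANCES UNDER SMALL STRAIN**: at a site-stress-free reference, for a `Λ_P`-invariant excised set and a rotation cocycle of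
strain `≤ τ` on non-excised pairs, `modelFarL(W_{r₀,v}) ≥ −λ·τ²·excisionMassL` — no dependence on the generating pair (normalise it to an
orthogonal one, §X1; bound `‖r₀‖‖v'‖ ≤ τ` by §X2 if a site survives, else the excision mass is `0`). -/
theorem modelFarL_rotField_ge_smallStrain (hS : IsSiteStressFree P) {lamQ τ : ℝ} (hlam : 0 ≤ lamQ) (hτ : 0 ≤ τ) {r₀ v : E3}
    (hW : SmallStrain τ P X (rotField r₀ v)) (hX : IsInvariantSet P X) :
    -(lamQ * τ ^ 2 * excisionMassL ϱχ D σ P X ϱ C) ≤ modelFarL ϱχ D σ (rotField r₀ v) P X lamQ ϱ C := by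
  obtain ⟨v', hv', hW'⟩ := exists_orthogonal_generator r₀ v
  rw [← hW'] at hW ⊢
  have hE := excisionMassL_nonneg ϱχ D σ P X ϱ C
  have hge := modelFarL_rotField_ge ϱχ D σ X ϱ C hS hlam r₀ v'
  by_cases hex : ∃ y ∈ P.points, y ∉ X
  · obtain ⟨y, hy, hyX⟩ := hex
    have hn := norm_mul_norm_le_of_smallStrain hτ hW hX hy hyX hv'
    have hn0 : 0 ≤ ‖r₀‖ * ‖v'‖ := by positivity
    have hsq : (‖r₀‖ * ‖v'‖) ^ 2 ≤ τ ^ 2 := pow_le_pow_left₀ hn0 hn 2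
    have h3 : lamQ * ((‖r₀‖ * ‖v'‖) ^ 2 * excisionMassL ϱχ D σ P X ϱ C) ≤ lamQ * (τ ^ 2 * excisionMassL ϱχ D σ P X ϱ C) :=
      mul_le_mul_of_nonneg_left (mul_le_mul_of_nonneg_right hsq hE) hlam
    linarith
  · push Not at hex
    have h0 : excisionMassL ϱχ D σ P X ϱ C = 0 :=
      excisionMassL_eq_zero_of_motif_subset ϱχ D σ X ϱ C fun y hy => hex y (P.mem_points_of_mem_motif hy)
    rw [h0] at hge ⊢
    simpa using hge

/-- ★★ **THE GEOMETRIC CHARGING FORM**: the conclusion of (H𝄪ˢ) for the instance `(β₀, k) = (W_{r₀,v}, 0)` holds as soon as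
`λ·τ²·excisionMassL ≤ C_T·shellMassL + Cχ·transMassL + C_H·pricedNearCountL` — a statement about the reference, the excised set and the weights. -/
theorem localS_conclusion_rotField_of_geomCharging (hS : IsSiteStressFree P) {lamQ τ : ℝ} (hlam : 0 ≤ lamQ) (hτ : 0 ≤ τ) {r₀ v : E3}
    (S : Fin 0 → CutPiece) (hW : SmallStrain τ P X (volterraField P S (rotField r₀ v))) (hX : IsInvariantSet P X) {C_T Cχ C_H : ℝ}
    (hch : lamQ * τ ^ 2 * excisionMassL ϱχ D σ P X ϱ C ≤
      C_T * shellMassL ϱχ D σ P X ϱ C + Cχ * transMassL ϱχ D σ P X ϱ C + C_H * (pricedNearCountL ϱχ D σ P X ϱ C : ℝ)) :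
    -(C_T * shellMassL ϱχ D σ P X ϱ C) - Cχ * transMassL ϱχ D σ P X ϱ C - C_H * (pricedNearCountL ϱχ D σ P X ϱ C : ℝ) ≤
      modelFarL ϱχ D σ (volterraField P S (rotField r₀ v)) P X lamQ ϱ C := by
  rw [volterraField_fin_zero] at hW ⊢
  have h := modelFarL_rotField_ge_smallStrain ϱχ D σ X ϱ C hS hlam hτ hW hX
  linarith

end GeomCharging

/-! ## §X4 The rotation sub-family of (H𝄪ˢ) and its reduction to a uniform geometric charging bound -/

section RotationFamily

variable (s lam ℓ μ₀ τ lamQ ϱ b₀ r_S C_T ϱχ Cχ : ℝ)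

/-- The **ROTATION SUB-FAMILY of (H𝄪ˢ)** `LocalSeamTransferBoundS`: its instances with `β₀ := W_{r₀,v}` a rotation cocycle and no seams
(`k := 0`), every other binder and the conclusion verbatim (so (H𝄪ˢ) ⟹ it by specialisation, `rotationFamilyS_of_localS`). -/
def RotationFamilyS : Prop :=
  ∃ C_H : ℝ, 0 ≤ C_H ∧ ∀ (P : PeriodicConfiguration 3) (C X : Set E3) (r₀ v : E3) (S : Fin 0 → CutPiece) (m : ℕ)
    (D : Fin m → Set E3) (σ : Fin m → Bool),
    IsSeparatedRef s P → IsLabelledRef lam ℓ P → IsForceFree P → IsSiteStressFree P → HarmStableModRot μ₀ P → IsInvariantSet P C →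
    IsInvariantSet P X → IsGlobalCocycle P (rotField r₀ v) → IsSeamSystem b₀ r_S P S →
    SmallStrain τ P X (volterraField P S (rotField r₀ v)) → (∀ i, IsInvariantSet P (D i)) →
    -(C_T * shellMassL ϱχ D σ P X ϱ C) - Cχ * transMassL ϱχ D σ P X ϱ C - C_H * (pricedNearCountL ϱχ D σ P X ϱ C : ℝ) ≤
      modelFarL ϱχ D σ (volterraField P S (rotField r₀ v)) P X lamQ ϱ C

/-- (H𝄪ˢ) ⟹ its rotation sub-family (specialisation `β₀ := W_{r₀,v}`, `k := 0`). -/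
theorem rotationFamilyS_of_localS (h : LocalSeamTransferBoundS s lam ℓ μ₀ τ lamQ ϱ b₀ r_S C_T ϱχ Cχ) :
    RotationFamilyS s lam ℓ μ₀ τ lamQ ϱ b₀ r_S C_T ϱχ Cχ := by
  obtain ⟨C_H, hC, hall⟩ := h
  exact ⟨C_H, hC, fun P C X r₀ v S m D σ => hall P C X (rotField r₀ v) 0 S m D σ⟩

/-- A **UNIFORM GEOMETRIC CHARGING BOUND** with constants `(A_T, A_χ, A_H)`: on every `s`-separated, `(lam, ℓ)`-labelled reference with
`Λ_P`-invariant centre set, excised set and localisation list, `excisionMassL ≤ A_T·shellMassL + A_χ·transMassL + A_H·pricedNearCountL`.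
Purely geometric (no cocycle, no equilibrium, no stability); part P-Y reduces it to its FAR residue. -/
def ExcisionChargingBound (s lam ℓ ϱ ϱχ A_T A_χ A_H : ℝ) : Prop :=
  ∀ (P : PeriodicConfiguration 3) (C X : Set E3) (m : ℕ) (D : Fin m → Set E3) (σ : Fin m → Bool),
    IsSeparatedRef s P → IsLabelledRef lam ℓ P → IsInvariantSet P C → IsInvariantSet P X → (∀ i, IsInvariantSet P (D i)) →
    excisionMassL ϱχ D σ P X ϱ C ≤
      A_T * shellMassL ϱχ D σ P X ϱ C + A_χ * transMassL ϱχ D σ P X ϱ C + A_H * (pricedNearCountL ϱχ D σ P X ϱ C : ℝ)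

variable {s lam ℓ μ₀ τ lamQ ϱ b₀ r_S C_T ϱχ Cχ}

/-- ★★ **THE ROTATION SUB-FAMILY FROM A UNIFORM GEOMETRIC CHARGING BOUND**: `ExcisionChargingBound … A_T A_χ A_H` with `λτ²·A_T ≤ C_T` and
`λτ²·A_χ ≤ Cχ` gives `RotationFamilyS` with `C_H := λτ²·A_H`. -/
theorem rotationFamilyS_of_excisionCharging (hlam : 0 ≤ lamQ) (hτ : 0 ≤ τ) {A_T A_χ A_H : ℝ} (hAH : 0 ≤ A_H)
    (hB : ExcisionChargingBound s lam ℓ ϱ ϱχ A_T A_χ A_H) (hT : lamQ * τ ^ 2 * A_T ≤ C_T) (hχ : lamQ * τ ^ 2 * A_χ ≤ Cχ) :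
    RotationFamilyS s lam ℓ μ₀ τ lamQ ϱ b₀ r_S C_T ϱχ Cχ := by
  refine ⟨lamQ * τ ^ 2 * A_H, by positivity, ?_⟩
  intro P C X r₀ v S m D σ hsep hlab _ hS _ hC hX _ _ hW hD
  refine localS_conclusion_rotField_of_geomCharging ϱχ D σ X ϱ C hS hlam hτ S hW hX ?_
  have hb := hB P C X m D σ hsep hlab hC hX hD
  have hsh := shellMassL_nonneg ϱχ D σ P X ϱ C
  have htr := transMassL_nonneg ϱχ D σ P X ϱ C
  have hlt : 0 ≤ lamQ * τ ^ 2 := by positivity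
  have h1 := mul_le_mul_of_nonneg_left hb hlt
  have h2 : lamQ * τ ^ 2 * A_T * shellMassL ϱχ D σ P X ϱ C ≤ C_T * shellMassL ϱχ D σ P X ϱ C := mul_le_mul_of_nonneg_right hT hsh
  have h3 : lamQ * τ ^ 2 * A_χ * transMassL ϱχ D σ P X ϱ C ≤ Cχ * transMassL ϱχ D σ P X ϱ C := mul_le_mul_of_nonneg_right hχ htr
  linarith

/-- Record dials `(s, τ, λ, C_T, Cχ) = (3/5, 3/100, 1/2, 1/(3·10⁶), 10⁻⁵)`: `λτ² = 4.5·10⁻⁴`; the admissible geometric constants are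
`A_T ≤ C_T/(λτ²) = 1/1350` and `A_χ ≤ Cχ/(λτ²) = 1/45` (both with equality). -/
theorem record_geomCharging_dials : (1 / 2 : ℝ) * (3 / 100) ^ 2 = 45 / 100000 ∧ (1 / 2 : ℝ) * (3 / 100) ^ 2 * (1 / 1350) = 1 / 3000000 ∧
    (1 / 2 : ℝ) * (3 / 100) ^ 2 * (1 / 45) = 1 / 100000 := by
  refine ⟨by norm_num, by norm_num, by norm_num⟩

/-- ★ THE RECORD ROTATION SUB-FAMILY from a geometric charging bound with `(A_T, A_χ) = (1/1350, 1/45)` and any `A_H ≥ 0`. -/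
theorem rotationFamilyS_record_of_excisionCharging {A_H : ℝ} (hAH : 0 ≤ A_H)
    (hB : ExcisionChargingBound (3 / 5) (1 / 3) 3 160 80 (1 / 1350) (1 / 45) A_H) :
    RotationFamilyS (3 / 5) (1 / 3) 3 (1 / 100) (3 / 100) (1 / 2) 160 (2 / 5) 3 (1 / 3000000) 80 (1 / 100000) :=
  rotationFamilyS_of_excisionCharging (by norm_num) (by norm_num) hAH hB (by norm_num) (by norm_num)

end RotationFamily

end Summit.AtomisticToContinuum.Crystallization.Theorems.ChargedEnergyGapChartDial

end
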